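import Literature.NumberTheory.LFunctions.BurnolSonineMultisetMinimalityProofs
import Literature.NumberTheory.LFunctions.BurnolSonineIndexTheoremsProofs
import Literature.NumberTheory.LFunctions.BurnolScriptL1DensityProofs
import Mathlib.Analysis.Analytic.Order
import Mathlib.Analysis.Analytic.Uniqueness
import HarnessLib

/-!
# Burnol 2004b, Lemmas 7.5 and 7.6: a minimal system of evaluators of `K_a` is not complete in any
# `K_b`, `b < a` — even after adding finitely many evaluators (proofs)

RH-FREE. LABEL: bears on **B-C / B-P of the `dbl/` column only through Burnol's index theorems
7.1–7.3** (`BurnolSonineIndexTheoremsProofs`: `Burnol2004b_thm7_1_of (h74) (h75)`,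
`Burnol2004b_thm7_2_of (h74) (h76)`), whose hypotheses `h75`, `h76` are discharged here.
WHAT THIS IS NOT: not a statement about the zeta multiset, not a density/completeness claim for
`K_a` itself (that is Lemma 7.4 / Prop. 4.3R), and nothing conditional on RH.

We prove the two named facts of `BurnolSonineZeros`,

* `Burnol2004b_lemma7_5_holds : Burnol2004b_lemma7_5` — "If the system of evaluators associated in a
  given `K_a` to a (non-empty) multiset `𝒵` is minimal, then it is not complete in any `K_b` with
  `b < a`" [cite: Burnol2004b, Lemma 7.5 (arXiv:math/0203120v7 p. 18)];
* `Burnol2004b_lemma7_6_holds : Burnol2004b_lemma7_6` — "… even after adding to the system of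
  evaluators associated with `𝒵` arbitrarily finitely many other evaluators"
  [cite: Burnol2004b, Lemma 7.6 (arXiv:math/0203120v7 p. 19)],

following the printed proof (TeX l.1472–1510 of arXiv:math/0203120v7) step by step:

1. (`exists_sonineFunction_of_isMinimalSystem`) minimality of the system in `K_a` gives, for a point
   `ρ` of `𝒵` of multiplicity `m`, a vector `g ⟂ Z^a_{w,k}` for all indices `≠ (ρ, m−1)` with
   `⟪Z^a_{ρ,m−1}, g⟫ ≠ 0` (`BurnolSonineIndex.exists_dual_vector_of_isMinimalSystem` of
   `BurnolSonineIndexTheoremsProofs`); its Riesz representative `G₀ ∈ K_a` for the bilinear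
   pairing `[f, G₀] = ⟪g, f⟫` (`BurnolEvaluators.exists_pairing_repr`) has entire completed Mellin
   transform `G = 𝒢_{G₀}` which "vanishes on the other part of `𝒵` but vanishes only to the
   `(m_ρ−1)`-th order at `ρ`" — by the defining property of the evaluators
   (`SonineMultiset.isSonineZ_sonineZ`, de Branges + Riesz, `BurnolSonineMultisetMinimalityProofs`).
2. (`exists_weight_mul_prod`, `scalingOp_mem_sonineK`, `completedMellinEntire_scalingOp`) "Let us
   now consider a function `F(s) = θ(s)G(s)` where `θ(s)` is the Mellin transform of a non-zero smooth
   function supported in an interval `[exp(−ε), exp(+ε)]`": with the Bochner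
   mollifier `ϑ(φ) = ∫ φ(τ)ϑ(e^τ) dτ` of `ConnesConsani2021.ScalingOperator` and the toolkit of
   `BurnolScriptL1DensityProofs` (`rightMellin_scalingOp`, `fourier_scalingOp`,
   `differentiable_mollMultiplier`, `mollMultiplier_eq_deriv`), `h = ϑ(φ)G₀ ∈ K_b` for
   `b ≤ a e^{−ε}` and `𝒢_h = Θ_φ·G` with `Θ_φ(s) = ∫ φ(τ)e^{τ(1/2−s)} dτ` entire; "Replacing `θ(s)` by
   `(s−ρ)θ(s)`" (Lemma 7.5) / "replace the function `θ(s)` from the preceding proof by `P(s)θ(s)` where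
   `P(s)` is an arbitrary polynomial" (Lemma 7.6) is done on the weight (`φ ↦ φ′ − (w₀ − 1/2)φ`
   multiplies `Θ_φ` by `s − w₀`), so that
   `Θ_φ = ∏(s − w₀)^{e(w₀)}·Θ_ψ` vanishes at `ρ` to order `F(ρ)+1` and at the added points `w₀` to
   order `F(w₀)`, `ψ` a bump with `Θ_ψ(1/2) = ∫ψ ≠ 0`.
3. (`exists_ne_zero_mem_sonineK_inner_sonineZ_eq_zero`) analytic orders add
   (`analyticOrderAt_mul`): `𝒢_h` vanishes at every `w` to order `≥ 𝒵(w) + F(w)`, and has finite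
   order at `ρ`, so `h ≠ 0` (if `h = 0` then `𝒢_h` vanishes on the strip, hence identically); the
   conjugate `f = h̄ ∈ K_b` is non-zero and `⟪Z^b_{w,k}, f⟫ = 2·𝒢_h^{(k)}(w) = 0` for all
   `k < 𝒵(w) + F(w)` — "Then `F(s)` (with the Gamma factor) vanishes on `𝒵` and this proves that the
   evaluators associated with `𝒵` are not complete in `L̂_b`" [sic: the Lemma's statement, and ours, is
   about `K_b`; `h ∈ K_b ⊆ L_b`]; the last step "orthogonal to every vector of the system ⇒ not
   complete" is `BurnolSonineIndex.eq_zero_of_isCompleteSystemIn` (`BurnolSonineIndexTheoremsProofs`).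

Lemma 7.5 is the case `F = 0`. No new definitions, no new named facts; two facts discharged.

## References
* [Burnol2004b] J.-F. Burnol, *Two complete and minimal systems associated with the zeros of the
  Riemann zeta function*, J. Théor. Nombres Bordeaux 16 (2004) 65–94, arXiv:math/0203120v7 —
  Lemmas 7.5 (TeX l.1466–1490), 7.6 (TeX l.1497–1510) and their proofs (§7, pp. 18–19); Thm. 4.9
  proof (p. 11, TeX l.912–944) for the mollifier; TeX of record
  `dbl/src/Burnol2004JTNB_arXivmath0203120v7.tex` (quotes above are verbatim from it).
-/

noncomputable section

open MeasureTheory Complex Filter Set FourierTransform Topology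
open scoped ComplexConjugate ENNReal InnerProductSpace
open Literature.Analysis.Fourier
open Literature.NumberTheory.ConnesConsani2021 (scalingUnitary scalingOp scalingUnitary_coeFn
  scalingUnitary_apply scalingUnitary_add integrable_smul_scalingUnitary scalingOp_apply evenPart
  mem_evenPart_iff)

namespace Literature.NumberTheory.LFunctions

namespace BurnolNonComplete

open BurnolEvaluators BurnolScriptL1Density

/-! ## A. From minimality (`BurnolSonineIndex.exists_dual_vector_of_isMinimalSystem`): the Sonine function `G₀ ∈ K_a` -/

/-- **Riesz representative in `K_a` for the bilinear pairing**: every `g ∈ L²(ℝ)` has a `G₀ ∈ K_a` with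
`[f, G₀] = ∫₀^∞ f·G₀ = ⟪g, f⟫` for all `f ∈ K_a` (the engine `BurnolEvaluators.exists_pairing_repr` at
the closed, conjugation-stable space `K_a`). [cite: Burnol2004b, §2 and Thm. 2.1 (arXiv:math/0203120v7 p. 5, TeX l.436–443, 474–479)] -/
theorem exists_mem_sonineK_pairing_eq_inner (a : ℝ) (g : Lp ℂ 2 (volume : Measure ℝ)) :
    ∃ G₀ ∈ sonineK a, ∀ f ∈ sonineK a, ∫ t in Ioi (0 : ℝ), f t * G₀ t = ⟪g, f⟫_ℂ :=
  exists_pairing_repr (isClosed_sonineK a) (zero_mem_sonineK a)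
    (fun _ hf _ hg ↦ add_mem_sonineK hf hg) (fun c _ hf ↦ smul_mem_sonineK c hf) (fun _ hf ↦ hf.1)
    (fun _ hu _ hv ↦ mem_sonineK_of_conj hu hv) (fun f ↦ ⟪g, f⟫_ℂ)
    (fun f _ f' _ ↦ inner_add_right g f f') (fun c f _ ↦ inner_smul_right g f c)
    ⟨‖g‖, fun f _ ↦ norm_inner_le_norm g f⟩

/-- **The Sonine function of the printed proof.** If the evaluators of `K_a` exist (`hZ`) and the
system attached to `𝒵` is minimal in `K_a`, then for `ρ` of multiplicity `m = 𝒵(ρ) ≥ 1` there is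
`G₀ ∈ K_a` whose entire completed Mellin transform `𝒢_{G₀}` vanishes on `𝒵` with multiplicity at every
index other than `(ρ, m−1)` and has `𝒢_{G₀}^{(m−1)}(ρ) ≠ 0` ("vanishes on the other part of `𝒵` but
vanishes only to the `(m_ρ−1)`-th order at `ρ`"). [cite: Burnol2004b, proof of Lemma 7.5 (arXiv:math/0203120v7 p. 18, TeX l.1472–1477)] -/
theorem exists_sonineFunction_of_isMinimalSystem
    (hZ : ∀ c : ℝ, 0 < c → ∀ (w : ℂ) (k : ℕ), IsSonineZ c w k (sonineZ c w k))
    {a : ℝ} (ha : 0 < a) {Z : ℂ → ℕ} (hmin : IsMinimalSystem (sonineZSystem a Z))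
    {ρ : ℂ} (hρ : 0 < Z ρ) :
    ∃ G₀ ∈ sonineK a,
      (∀ (w : ℂ) (k : ℕ), k < Z w → (w, k) ≠ (ρ, Z ρ - 1) →
        iteratedDeriv k (completedMellinEntire (G₀ : ℝ → ℂ)) w = 0) ∧
      iteratedDeriv (Z ρ - 1) (completedMellinEntire (G₀ : ℝ → ℂ)) ρ ≠ 0 := by
  have hlt : Z ρ - 1 < Z ρ := by omega
  set i₀ : MultisetIndex Z := ⟨(ρ, Z ρ - 1), hlt⟩ with hi₀
  obtain ⟨g, hg0, hg1⟩ := BurnolSonineIndex.exists_dual_vector_of_isMinimalSystem hmin i₀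
  obtain ⟨G₀, hG₀K, hG₀⟩ := exists_mem_sonineK_pairing_eq_inner a g
  have key : ∀ (w : ℂ) (k : ℕ),
      iteratedDeriv k (completedMellinEntire (G₀ : ℝ → ℂ)) w = ⟪g, sonineZ a w k⟫_ℂ := by
    intro w k
    have hZw := hZ a ha w k
    rw [← hZw.2 G₀ hG₀K, ← hG₀ _ hZw.1]
    exact integral_congr_ae (Eventually.of_forall fun t ↦ mul_comm _ _)
  refine ⟨G₀, hG₀K, fun w k hk hne ↦ ?_, ?_⟩
  · rw [key, inner_eq_zero_symm]
    have hj : (⟨(w, k), hk⟩ : MultisetIndex Z) ≠ i₀ := by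
      intro h
      apply hne
      exact congrArg Subtype.val h
    exact hg0 ⟨(w, k), hk⟩ hj
  · rw [key, Ne, inner_eq_zero_symm]
    exact hg1

/-! ## B. The Mellin multiplier: one root at a time, `w ↦ w′ − (w₀ − 1/2)w` -/

/-- `Θ_{w′}(s) = (s − 1/2)·Θ_w(s)` for every `s` (integration by parts; at `s = 1/2` by continuity).
[cite: Burnol2004b, proof of Thm. 4.9 (arXiv:math/0203120v7 p. 11, TeX l.914–917)] -/
theorem mollMultiplier_deriv {w : ℝ → ℂ} (hw : ContDiff ℝ (⊤ : ℕ∞) w) (hws : HasCompactSupport w)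
    (s : ℂ) :
    (∫ τ : ℝ, deriv w τ * cexp ((τ : ℂ) * (1 / 2 - s))) =
      (s - 1 / 2) * ∫ τ : ℝ, w τ * cexp ((τ : ℂ) * (1 / 2 - s)) := by
  have h1 : ContDiff ℝ 1 w := hw.of_le (by exact_mod_cast le_top)
  have hw' : ContDiff ℝ (⊤ : ℕ∞) (deriv w) := (contDiff_infty_iff_deriv.mp hw).2
  have hA : Continuous fun s : ℂ ↦ ∫ τ : ℝ, deriv w τ * cexp ((τ : ℂ) * (1 / 2 - s)) :=
    (differentiable_mollMultiplier hw'.continuous hws.deriv).continuous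
  have hB : Continuous fun s : ℂ ↦ (s - 1 / 2) * ∫ τ : ℝ, w τ * cexp ((τ : ℂ) * (1 / 2 - s)) :=
    (continuous_id.sub continuous_const).mul
      (differentiable_mollMultiplier hw.continuous hws).continuous
  have hEq : Set.EqOn (fun s : ℂ ↦ ∫ τ : ℝ, deriv w τ * cexp ((τ : ℂ) * (1 / 2 - s)))
      (fun s : ℂ ↦ (s - 1 / 2) * ∫ τ : ℝ, w τ * cexp ((τ : ℂ) * (1 / 2 - s))) {s | s ≠ 1 / 2} := by
    intro s hs
    have h := mollMultiplier_eq_deriv h1 hws (s := s) hs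
    have hu : (1 / 2 - s : ℂ) ≠ 0 := sub_ne_zero.2 (Ne.symm hs)
    beta_reduce
    set X := ∫ τ : ℝ, deriv w τ * cexp ((τ : ℂ) * (1 / 2 - s)) with hX
    set Y := ∫ τ : ℝ, w τ * cexp ((τ : ℂ) * (1 / 2 - s)) with hY
    have key : (s - 1 / 2) * -((1 / 2 - s)⁻¹ * X) = X := by
      rw [show (s - 1 / 2 : ℂ) = -(1 / 2 - s) by ring, neg_mul, mul_neg, neg_neg, ← mul_assoc,
        mul_inv_cancel₀ hu, one_mul]
    rw [h, key]
  have hcl : closure {s : ℂ | s ≠ 1 / 2} = Set.univ := (dense_compl_singleton (1 / 2 : ℂ)).closure_eq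
  have := hEq.closure hA hB
  rw [hcl] at this
  exact this (Set.mem_univ s)

/-- The multiplier integrand of a continuous compactly supported weight is integrable. [folklore] -/
private theorem integrable_mollMultiplier {w : ℝ → ℂ} (hw : Continuous w) (hws : HasCompactSupport w)
    (s : ℂ) : Integrable fun τ : ℝ ↦ w τ * cexp ((τ : ℂ) * (1 / 2 - s)) :=
  (hw.mul (by fun_prop)).integrable_of_hasCompactSupport hws.mul_right

/-- **One root at a time.** From a smooth weight `w` supported in `[−ε, ε]` and `w₀ ∈ ℂ`, the weight
`w₁ := w′ − (w₀ − 1/2)w` (smooth, same support) has multiplier `Θ_{w₁}(s) = (s − w₀)Θ_w(s)`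
("Replacing `θ(s)` by `(s−ρ)θ(s)` we may impose `θ(ρ) = 0`").
[cite: Burnol2004b, proof of Lemma 7.5 (arXiv:math/0203120v7 p. 18, TeX l.1486–1488)] -/
theorem exists_weight_mul_linear {w : ℝ → ℂ} (hw : ContDiff ℝ (⊤ : ℕ∞) w)
    (hws : HasCompactSupport w) {ε : ℝ} (hwε : ∀ τ, ε < |τ| → w τ = 0) (w₀ : ℂ) :
    ∃ w₁ : ℝ → ℂ, ContDiff ℝ (⊤ : ℕ∞) w₁ ∧ HasCompactSupport w₁ ∧ (∀ τ, ε < |τ| → w₁ τ = 0) ∧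
      ∀ s : ℂ, (∫ τ : ℝ, w₁ τ * cexp ((τ : ℂ) * (1 / 2 - s))) =
        (s - w₀) * ∫ τ : ℝ, w τ * cexp ((τ : ℂ) * (1 / 2 - s)) := by
  have hw' : ContDiff ℝ (⊤ : ℕ∞) (deriv w) := (contDiff_infty_iff_deriv.mp hw).2
  have hopen : IsOpen {τ : ℝ | ε < |τ|} := isOpen_lt continuous_const continuous_abs
  refine ⟨fun τ ↦ deriv w τ - (w₀ - 1 / 2) * w τ, hw'.sub (contDiff_const.mul hw),
    hws.deriv.sub hws.mul_left, fun τ hτ ↦ ?_, fun s ↦ ?_⟩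
  · have hev : w =ᶠ[𝓝 τ] fun _ ↦ (0 : ℂ) := by
      filter_upwards [hopen.mem_nhds hτ] with x hx using hwε x hx
    beta_reduce
    rw [hev.deriv_eq, deriv_const, hwε τ hτ, mul_zero, sub_zero]
  · have e : (fun τ : ℝ ↦ (deriv w τ - (w₀ - 1 / 2) * w τ) * cexp ((τ : ℂ) * (1 / 2 - s))) =
        fun τ ↦ deriv w τ * cexp ((τ : ℂ) * (1 / 2 - s)) -
          (w₀ - 1 / 2) * (w τ * cexp ((τ : ℂ) * (1 / 2 - s))) := by
      funext τ; ring
    rw [e, integral_sub (integrable_mollMultiplier hw'.continuous hws.deriv s)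
      ((integrable_mollMultiplier hw.continuous hws s).const_mul _), integral_const_mul,
      mollMultiplier_deriv hw hws]
    ring

/-- **A power of one root**: a weight `wₙ` with `Θ_{wₙ}(s) = (s − w₀)^n Θ_w(s)`.
[cite: Burnol2004b, proofs of Lemmas 7.5–7.6 (arXiv:math/0203120v7 pp. 18–19, TeX l.1486–1488, 1506–1510)] -/
theorem exists_weight_mul_pow {w : ℝ → ℂ} (hw : ContDiff ℝ (⊤ : ℕ∞) w)
    (hws : HasCompactSupport w) {ε : ℝ} (hwε : ∀ τ, ε < |τ| → w τ = 0) (w₀ : ℂ) (n : ℕ) :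
    ∃ w₁ : ℝ → ℂ, ContDiff ℝ (⊤ : ℕ∞) w₁ ∧ HasCompactSupport w₁ ∧ (∀ τ, ε < |τ| → w₁ τ = 0) ∧
      ∀ s : ℂ, (∫ τ : ℝ, w₁ τ * cexp ((τ : ℂ) * (1 / 2 - s))) =
        (s - w₀) ^ n * ∫ τ : ℝ, w τ * cexp ((τ : ℂ) * (1 / 2 - s)) := by
  induction n with
  | zero => exact ⟨w, hw, hws, hwε, fun s ↦ by rw [pow_zero, one_mul]⟩
  | succ n ih =>
    obtain ⟨w₁, h₁, h₁s, h₁ε, h₁m⟩ := ih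
    obtain ⟨w₂, h₂, h₂s, h₂ε, h₂m⟩ := exists_weight_mul_linear h₁ h₁s h₁ε w₀
    exact ⟨w₂, h₂, h₂s, h₂ε, fun s ↦ by rw [h₂m, h₁m, pow_succ]; ring⟩

/-- **Finitely many roots with multiplicities** ("We only have to replace the function `θ(s)` from
the preceding proof by `P(s)θ(s)` where `P(s)` is an arbitrary polynomial"): for a finite set `S` and
exponents `e`, a weight with multiplier `(∏_{w₀∈S} (s − w₀)^{e w₀})·Θ_w(s)`. [cite: Burnol2004b, proof of Lemma 7.6 (arXiv:math/0203120v7 p. 19, TeX l.1506–1510)] -/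
theorem exists_weight_mul_prod {w : ℝ → ℂ} (hw : ContDiff ℝ (⊤ : ℕ∞) w)
    (hws : HasCompactSupport w) {ε : ℝ} (hwε : ∀ τ, ε < |τ| → w τ = 0) (S : Finset ℂ) (e : ℂ → ℕ) :
    ∃ w₁ : ℝ → ℂ, ContDiff ℝ (⊤ : ℕ∞) w₁ ∧ HasCompactSupport w₁ ∧ (∀ τ, ε < |τ| → w₁ τ = 0) ∧
      ∀ s : ℂ, (∫ τ : ℝ, w₁ τ * cexp ((τ : ℂ) * (1 / 2 - s))) =
        (∏ w₀ ∈ S, (s - w₀) ^ e w₀) * ∫ τ : ℝ, w τ * cexp ((τ : ℂ) * (1 / 2 - s)) := by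
  classical
  induction S using Finset.induction_on with
  | empty => exact ⟨w, hw, hws, hwε, fun s ↦ by rw [Finset.prod_empty, one_mul]⟩
  | insert w₀ S hw₀ ih =>
    obtain ⟨w₁, h₁, h₁s, h₁ε, h₁m⟩ := ih
    obtain ⟨w₂, h₂, h₂s, h₂ε, h₂m⟩ := exists_weight_mul_pow h₁ h₁s h₁ε w₀ (e w₀)
    exact ⟨w₂, h₂, h₂s, h₂ε, fun s ↦ by rw [h₂m, h₁m, Finset.prod_insert hw₀]; ring⟩

/-! ## C. Analytic orders of the polynomial factor -/

/-- Order of a linear factor: `ord_w (s − w₀) = 1` if `w₀ = w`, else `0`. [folklore] -/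
private theorem analyticOrderAt_sub_const (w₀ w : ℂ) :
    analyticOrderAt (fun s : ℂ ↦ s - w₀) w = if w₀ = w then (1 : ℕ∞) else 0 := by
  have ha : AnalyticAt ℂ (fun s : ℂ ↦ s - w₀) w := analyticAt_id.sub analyticAt_const
  split_ifs with h
  · subst h
    apply ha.analyticOrderAt_eq_one_of_zero_deriv_ne_zero
    · simp
    · rw [deriv_sub_const]; simp
  · rw [ha.analyticOrderAt_eq_zero]
    exact sub_ne_zero.2 (Ne.symm h)

/-- Order of the polynomial `Q_S(s) = ∏_{w₀∈S} (s − w₀)^{e w₀}` at `w`: `e w` if `w ∈ S`, else `0`.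
[folklore] -/
private theorem analyticOrderAt_prod_pow (S : Finset ℂ) (e : ℂ → ℕ) (w : ℂ) :
    analyticOrderAt (fun s : ℂ ↦ ∏ w₀ ∈ S, (s - w₀) ^ e w₀) w =
      ((if w ∈ S then e w else 0 : ℕ) : ℕ∞) := by
  classical
  induction S using Finset.induction_on with
  | empty =>
    simp only [Finset.prod_empty, Finset.notMem_empty, if_false, Nat.cast_zero]
    exact analyticAt_const.analyticOrderAt_eq_zero.2 one_ne_zero
  | insert w₀ S hw₀ ih =>
    have hlin : AnalyticAt ℂ (fun s : ℂ ↦ s - w₀) w := analyticAt_id.sub analyticAt_const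
    have hpow : AnalyticAt ℂ (fun s : ℂ ↦ (s - w₀) ^ e w₀) w := hlin.pow _
    have hrest : AnalyticAt ℂ (fun s : ℂ ↦ ∏ x ∈ S, (s - x) ^ e x) w :=
      Finset.analyticAt_fun_prod S fun x _ ↦ (analyticAt_id.sub analyticAt_const).pow _
    have e1 : (fun s : ℂ ↦ ∏ x ∈ insert w₀ S, (s - x) ^ e x) =
        (fun s : ℂ ↦ (s - w₀) ^ e w₀) * fun s : ℂ ↦ ∏ x ∈ S, (s - x) ^ e x := by
      funext s
      rw [Finset.prod_insert hw₀, Pi.mul_apply]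
    have e2 : (fun s : ℂ ↦ (s - w₀) ^ e w₀) = (fun s : ℂ ↦ s - w₀) ^ e w₀ := by
      funext s; simp [Pi.pow_apply]
    rw [e1, analyticOrderAt_mul hpow hrest, ih, e2, analyticOrderAt_pow hlin, analyticOrderAt_sub_const]
    by_cases h : w₀ = w
    · subst h
      simp [hw₀]
    · have hne : ¬ (w = w₀) := fun h' ↦ h h'.symm
      simp [h, Finset.mem_insert, hne]

/-! ## D. The mollifier `ϑ(w)G₀` lies in `K_b` -/

/-- `x ↦ c·x` (`c ≠ 0`) is quasi-measure-preserving for Lebesgue measure. [folklore] -/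
private theorem quasiMeasurePreserving_const_mul {c : ℝ} (hc : c ≠ 0) :
    Measure.QuasiMeasurePreserving (fun x : ℝ ↦ c * x) volume volume := by
  refine ⟨measurable_const_mul c, ?_⟩
  rw [Real.map_volume_mul_left hc]
  exact Measure.smul_absolutelyContinuous

/-- A dilate of a function vanishing on `(0,A)` vanishes on `(0,b)` when `b ≤ A e^{τ}`:
`ϑ(e^τ)G₀ = 0` a.e. on `(0,b)`. [cite: Burnol2004b, proof of Lemma 7.5 (arXiv:math/0203120v7 p. 18, TeX l.1484–1486: "for any b ≤ exp(−ε)a")] -/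
theorem scalingUnitary_ae_zero_Ioo {G₀ : Lp ℂ 2 (volume : Measure ℝ)} {A b τ : ℝ}
    (hG : ∀ᵐ x : ℝ, x ∈ Ioo 0 A → (G₀ : ℝ → ℂ) x = 0) (hb : b ≤ A * Real.exp τ) :
    ∀ᵐ x : ℝ, x ∈ Ioo 0 b → (scalingUnitary τ G₀ : ℝ → ℂ) x = 0 := by
  have hq := quasiMeasurePreserving_const_mul (Real.exp_pos (-τ)).ne'
  filter_upwards [scalingUnitary_coeFn τ G₀, hq.ae hG] with x hx hx' hxb
  rw [hx, hx' ⟨mul_pos (Real.exp_pos _) hxb.1, ?_⟩, mul_zero]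
  calc Real.exp (-τ) * x < Real.exp (-τ) * b := by gcongr; exact hxb.2
    _ ≤ Real.exp (-τ) * (A * Real.exp τ) := by gcongr
    _ = A := by rw [mul_comm A, ← mul_assoc, ← Real.exp_add, neg_add_cancel, Real.exp_zero, one_mul]

/-- `1_S f = 0` in `L²` when `f` vanishes a.e. on `S`. [folklore] -/
private theorem indicatorLp_eq_zero_of_ae {S : Set ℝ} (hS : MeasurableSet S) {f : Lp ℂ 2 (volume : Measure ℝ)}
    (hf : ∀ᵐ x : ℝ, x ∈ S → (f : ℝ → ℂ) x = 0) :
    Literature.Analysis.OperatorTheory.indicatorLp (volume : Measure ℝ) 2 hS f = 0 := by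
  apply Lp.ext
  filter_upwards [Literature.Analysis.OperatorTheory.indicatorLp_coeFn hS f, hf,
    Lp.coeFn_zero ℂ 2 (volume : Measure ℝ)] with x hx hfx h0
  rw [hx, h0, Pi.zero_apply]
  by_cases hxS : x ∈ S
  · rw [Set.indicator_of_mem hxS, hfx hxS]
  · rw [Set.indicator_of_notMem hxS]

/-- `f` vanishes a.e. on `S` when `1_S f = 0` in `L²`. [folklore] -/
private theorem ae_zero_of_indicatorLp_eq_zero {S : Set ℝ} (hS : MeasurableSet S)
    {f : Lp ℂ 2 (volume : Measure ℝ)}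
    (hf : Literature.Analysis.OperatorTheory.indicatorLp (volume : Measure ℝ) 2 hS f = 0) :
    ∀ᵐ x : ℝ, x ∈ S → (f : ℝ → ℂ) x = 0 := by
  have h := Literature.Analysis.OperatorTheory.indicatorLp_coeFn hS f
  rw [hf] at h
  filter_upwards [h, Lp.coeFn_zero ℂ 2 (volume : Measure ℝ)] with x hx h0 hxS
  have := hx.symm
  rw [Set.indicator_of_mem hxS, h0, Pi.zero_apply] at this
  exact this

/-- **Support of the mollifier** (Bochner form): if `G₀ = 0` a.e. on `(0,A)` and `b ≤ A e^{τ}` on the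
support of the weight, then `ϑ(w)G₀ = 0` a.e. on `(0,b)` ("The support of this multiplicative
convolution will be included in …"). [cite: Burnol2004b, proof of Thm. 4.9 and of Lemma 7.5 (arXiv:math/0203120v7 pp. 11, 18; TeX l.931–935, 1484–1486)] -/
theorem scalingOp_ae_zero_Ioo {w : ℝ → ℂ} (hw : Integrable w) {G₀ : Lp ℂ 2 (volume : Measure ℝ)}
    {A b : ℝ} (hG : ∀ᵐ x : ℝ, x ∈ Ioo 0 A → (G₀ : ℝ → ℂ) x = 0)
    (hwb : ∀ τ, w τ ≠ 0 → b ≤ A * Real.exp τ) :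
    ∀ᵐ x : ℝ, x ∈ Ioo 0 b → (scalingOp w G₀ : ℝ → ℂ) x = 0 := by
  apply ae_zero_of_indicatorLp_eq_zero measurableSet_Ioo
  rw [scalingOp_apply hw, ← ContinuousLinearMap.integral_comp_comm _ (integrable_smul_scalingUnitary hw G₀)]
  refine integral_eq_zero_of_ae (Eventually.of_forall fun τ ↦ ?_)
  by_cases hτ : w τ = 0
  · simp [hτ]
  · have h0 : Literature.Analysis.OperatorTheory.indicatorLp (volume : Measure ℝ) 2
        (measurableSet_Ioo : MeasurableSet (Ioo (0 : ℝ) b)) (w τ • scalingUnitary τ G₀) = 0 := by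
      rw [map_smul, indicatorLp_eq_zero_of_ae measurableSet_Ioo
        (scalingUnitary_ae_zero_Ioo hG (hwb τ hτ)), smul_zero]
    simpa using h0

/-- **The mollifier of a vector of `K_a` lies in `K_b`** for `b ≤ a e^{−ε}` when the weight is
supported in `[−ε, ε]`: evenness (`scalingOp_mem_evenPart`), vanishing on `(0,b)`
(`scalingOp_ae_zero_Ioo`), and the same for the cosine transform via `𝓕ϑ(w) = ϑ(w(−·))𝓕`
(`fourier_scalingOp`). [cite: Burnol2004b, proof of Lemma 7.5 (arXiv:math/0203120v7 p. 18, TeX l.1478–1486: "any such F(s) is a non-zero element of L̂_b for any b ≤ exp(−ε)a")] -/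
theorem scalingOp_mem_sonineK {w : ℝ → ℂ} (hw : Integrable w) {ε : ℝ}
    (hwε : ∀ τ, ε < |τ| → w τ = 0) {a b : ℝ} (hb : 0 < b) (hba : b ≤ a * Real.exp (-ε))
    {G₀ : Lp ℂ 2 (volume : Measure ℝ)} (hG₀ : G₀ ∈ sonineK a) :
    scalingOp w G₀ ∈ sonineK b := by
  obtain ⟨hev, h0, hF0⟩ := hG₀
  have ha : 0 < a := (mul_pos_iff_of_pos_right (Real.exp_pos (-ε))).1 (hb.trans_le hba)
  have hwb : ∀ τ, w τ ≠ 0 → b ≤ a * Real.exp τ := by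
    intro τ hτ
    have hτε : |τ| ≤ ε := not_lt.1 fun h ↦ hτ (hwε τ h)
    have : -ε ≤ τ := by linarith [neg_abs_le τ]
    calc b ≤ a * Real.exp (-ε) := hba
      _ ≤ a * Real.exp τ := by gcongr
  have hwb' : ∀ τ, w (-τ) ≠ 0 → b ≤ a * Real.exp τ := by
    intro τ hτ
    have hτε : |τ| ≤ ε := by
      have := not_lt.1 fun h ↦ hτ (hwε (-τ) h)
      simpa using this
    have : -ε ≤ τ := by linarith [neg_abs_le τ]
    calc b ≤ a * Real.exp (-ε) := hba
      _ ≤ a * Real.exp τ := by gcongr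
  refine ⟨scalingOp_mem_evenPart hw hev, scalingOp_ae_zero_Ioo hw h0 hwb, ?_⟩
  rw [fourier_scalingOp hw]
  exact scalingOp_ae_zero_Ioo hw.comp_neg hF0 hwb'

/-! ## E. The Mellin transform of the mollifier: `(ϑ(w)G₀)^ = Θ_w·Ĝ₀`, `𝒢_{ϑ(w)G₀} = Θ_w·𝒢_{G₀}` -/

/-- Dilations commute with the mollifier: `ϑ(e^β)(ϑ(w)G₀) = ϑ(w)(ϑ(e^β)G₀)`. [folklore] -/
private theorem scalingUnitary_scalingOp {w : ℝ → ℂ} (hw : Integrable w) (β : ℝ)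
    (G₀ : Lp ℂ 2 (volume : Measure ℝ)) :
    scalingUnitary β (scalingOp w G₀) = scalingOp w (scalingUnitary β G₀) := by
  rw [scalingOp_apply hw, scalingOp_apply hw,
    ← ContinuousLinearMap.integral_comp_comm _ (integrable_smul_scalingUnitary hw G₀)]
  refine integral_congr_ae (Eventually.of_forall fun τ ↦ ?_)
  beta_reduce
  rw [map_smul]
  congr 1
  rw [← ContinuousLinearMap.comp_apply, ← scalingUnitary_add, add_comm, scalingUnitary_add,
    ContinuousLinearMap.comp_apply]

/-- **`(ϑ(w)G₀)^(s) = Θ_w(s)·Ĝ₀(s)` on `1/2 < Re s < 1` for `G₀ ∈ K_a`, ANY `a > 0`** (the toolkit lemma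
`rightMellin_scalingOp` needs the vector to vanish on `(0, e^{R})`, `R` a bound for the support of the
weight; we first dilate `G₀ ∈ K_a` by `ϑ(e^β)`, `a e^{β} = e^{R}`, and the factors `e^{β(1/2−s)}` cancel).
[cite: Burnol2004b, proof of Lemma 7.5 (arXiv:math/0203120v7 p. 18, TeX l.1477–1478: "Let us now consider a function F(s) = θ(s)G(s)")] -/
theorem rightMellin_scalingOp_of_mem_sonineK {w : ℝ → ℂ} (hw : Continuous w)
    (hws : HasCompactSupport w) {a : ℝ} (ha : 0 < a) {G₀ : Lp ℂ 2 (volume : Measure ℝ)}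
    (hG₀ : G₀ ∈ sonineK a) {s : ℂ} (hs1 : 1 / 2 < s.re) (hs2 : s.re < 1) :
    rightMellin (scalingOp w G₀ : ℝ → ℂ) s =
      (∫ τ : ℝ, w τ * cexp ((τ : ℂ) * (1 / 2 - s))) * rightMellin (G₀ : ℝ → ℂ) s := by
  have hwi : Integrable w := hw.integrable_of_hasCompactSupport hws
  -- a bound `R` for the support of `w`
  obtain ⟨R, hR⟩ : ∃ R : ℝ, ∀ τ, w τ ≠ 0 → |τ| ≤ R := by
    obtain ⟨R, hR⟩ := (hws.isCompact.isBounded).subset_closedBall (0 : ℝ)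
    refine ⟨R, fun τ hτ ↦ ?_⟩
    have : τ ∈ Metric.closedBall (0 : ℝ) R := hR (subset_tsupport _ (Function.mem_support.2 hτ))
    simpa [Real.dist_eq] using this
  -- dilate: `G₁ = ϑ(e^β)G₀` vanishes on `(0, e^R)`
  set β : ℝ := R - Real.log a with hβ
  have haβ : a * Real.exp β = Real.exp R := by
    rw [hβ, Real.exp_sub, Real.exp_log ha]; field_simp
  have hG₁ : ∀ᵐ x : ℝ, x ∈ Ioo 0 (Real.exp R) → (scalingUnitary β G₀ : ℝ → ℂ) x = 0 :=
    scalingUnitary_ae_zero_Ioo hG₀.2.1 haβ.symm.le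
  have hG₁' : ∀ᵐ x : ℝ, x ∈ Ioo 0 (Real.exp R) → (scalingUnitary β G₀ : ℝ → ℂ) x = (0 : ℂ) := hG₁
  have hwb : ∀ τ, w τ ≠ 0 → Real.exp (-τ) ≤ Real.exp R := fun τ hτ ↦ by
    have := hR τ hτ
    exact Real.exp_le_exp.2 (by linarith [neg_abs_le τ, le_abs_self τ, abs_neg τ, neg_le_abs τ])
  have h := rightMellin_scalingOp hw hws hwb hG₁' hs1 hs2
  rw [← scalingUnitary_scalingOp hwi, rightMellin_scalingUnitary, rightMellin_scalingUnitary] at h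
  have hexp : cexp ((β : ℂ) * (1 / 2 - s)) ≠ 0 := Complex.exp_ne_zero _
  have h2 : cexp ((β : ℂ) * (1 / 2 - s)) * rightMellin (scalingOp w G₀ : ℝ → ℂ) s =
      cexp ((β : ℂ) * (1 / 2 - s)) *
        ((∫ τ : ℝ, w τ * cexp ((τ : ℂ) * (1 / 2 - s))) * rightMellin (G₀ : ℝ → ℂ) s) := by
    rw [h]; ring
  exact mul_left_cancel₀ hexp h2

/-- **`𝒢_{ϑ(w)G₀} = Θ_w · 𝒢_{G₀}`** for `G₀ ∈ K_a` and `ϑ(w)G₀ ∈ K_b` (both sides are entire and agree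
with `Γ_ℝ(s)·(ϑ(w)G₀)^(s)` on the strip; uniqueness of the entire continuation).
[cite: Burnol2004b, proof of Lemma 7.5 (arXiv:math/0203120v7 p. 18, TeX l.1477–1489: "Then F(s) (with the Gamma factor) vanishes on 𝒵")] -/
theorem completedMellinEntire_scalingOp {w : ℝ → ℂ} (hw : Continuous w) (hws : HasCompactSupport w)
    {a b : ℝ} (ha : 0 < a) (hb : 0 < b) {G₀ : Lp ℂ 2 (volume : Measure ℝ)} (hG₀ : G₀ ∈ sonineK a)
    (hh : scalingOp w G₀ ∈ sonineK b) :
    completedMellinEntire (scalingOp w G₀ : ℝ → ℂ) =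
      fun s ↦ (∫ τ : ℝ, w τ * cexp ((τ : ℂ) * (1 / 2 - s))) * completedMellinEntire (G₀ : ℝ → ℂ) s := by
  have hG := hasCompletedMellinEntire_of_mem_sonineK ha hG₀
  have hH := hasCompletedMellinEntire_of_mem_sonineK hb hh
  refine hH.eq ⟨(differentiable_mollMultiplier hw hws).mul hG.1, fun s hs1 hs2 ↦ ?_⟩
  beta_reduce
  rw [hG.2 s hs1 hs2, rightMellin_scalingOp_of_mem_sonineK hw hws ha hG₀ hs1 hs2]
  ring

/-- `f̂ ≡ 0` for an a.e.-zero `f`. [folklore] -/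
private theorem rightMellin_eq_zero_of_ae_zero {f : ℝ → ℂ} (hf : f =ᵐ[volume] 0) (s : ℂ) :
    rightMellin f s = 0 := by
  have h : (fun t : ℝ ↦ (t : ℂ) ^ (1 - s - 1) • f t) =ᵐ[volume.restrict (Ioi (0 : ℝ))]
      fun _ ↦ (0 : ℂ) :=
    (ae_restrict_of_ae hf).mono fun t ht ↦ by simp only [ht, Pi.zero_apply, smul_zero]
  simp only [rightMellin, mellin]
  rw [integral_congr_ae h, integral_zero]

/-! ## F. Assembly: a non-zero vector of `K_b` orthogonal to every evaluator of `𝒵 + F` -/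

/-- **The heart of Lemmas 7.5/7.6.** Assume the `§7` evaluators exist (`hZ`). If the system of `𝒵`
(non-empty) is minimal in `K_a` and `0 < b < a`, then for every finitely supported `F` there is a
NON-ZERO `f ∈ K_b` orthogonal to every evaluator `Z^b_{w,k}`, `k < 𝒵(w) + F(w)`: `f = h̄` with
`h = ϑ(φ)G₀` the mollification of the Sonine function `G₀` of `exists_sonineFunction_of_isMinimalSystem`
by a weight `φ` with multiplier `∏(s−w₀)^{e w₀}·Θ_ψ` (`ψ` a bump in `[−ε/2, ε/2]`, `a e^{−ε} = b`).
[cite: Burnol2004b, proof of Lemmas 7.5–7.6 (arXiv:math/0203120v7 pp. 18–19, TeX l.1472–1510)] -/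
theorem exists_ne_zero_mem_sonineK_inner_sonineZ_eq_zero
    (hZ : ∀ c : ℝ, 0 < c → ∀ (w : ℂ) (k : ℕ), IsSonineZ c w k (sonineZ c w k))
    {Z : ℂ → ℕ} (hZ0 : Z ≠ 0) {a : ℝ} (ha : 0 < a) (hmin : IsMinimalSystem (sonineZSystem a Z))
    {b : ℝ} (hb : 0 < b) (hba : b < a) {F : ℂ → ℕ} (hF : (Function.support F).Finite) :
    ∃ f ∈ sonineK b, f ≠ 0 ∧ ∀ (w : ℂ) (k : ℕ), k < Z w + F w → ⟪sonineZ b w k, f⟫_ℂ = 0 := by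
  classical
  -- a point `ρ` of the multiset
  obtain ⟨ρ, hρ⟩ : ∃ ρ, Z ρ ≠ 0 := by
    by_contra h
    push Not at h
    exact hZ0 (funext h)
  have hρpos : 0 < Z ρ := Nat.pos_of_ne_zero hρ
  -- the Sonine function `G₀` and its entire completed transform `G`
  obtain ⟨G₀, hG₀K, hG0, hG1⟩ := exists_sonineFunction_of_isMinimalSystem hZ ha hmin hρpos
  set G : ℂ → ℂ := completedMellinEntire (G₀ : ℝ → ℂ) with hGdef
  have hGent : Differentiable ℂ G := (hasCompletedMellinEntire_of_mem_sonineK ha hG₀K).1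
  have hGan : ∀ w, AnalyticAt ℂ G w := fun w ↦ hGent.analyticAt w
  have hordG : ∀ w, w ≠ ρ → ((Z w : ℕ) : ℕ∞) ≤ analyticOrderAt G w := by
    intro w hw
    rw [natCast_le_analyticOrderAt_iff_iteratedDeriv_eq_zero (hGan w)]
    intro i hi
    refine hG0 w i hi ?_
    intro h
    exact hw (congrArg Prod.fst h)
  have hordGρ : analyticOrderAt G ρ = ((Z ρ - 1 : ℕ) : ℕ∞) := by
    rw [analyticOrderAt_eq_nat_iff_iteratedDeriv_eq_zero (hGan ρ)]
    refine ⟨fun k hk ↦ hG0 ρ k (by omega) ?_, hG1⟩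
    intro h
    have := congrArg Prod.snd h
    simp only at this
    omega
  -- `ε > 0` with `a e^{−ε} = b`
  set ε : ℝ := Real.log (a / b) with hε
  have hab : 1 < a / b := (one_lt_div hb).2 hba
  have hεpos : 0 < ε := Real.log_pos hab
  have hba' : b ≤ a * Real.exp (-ε) := by
    rw [hε, Real.exp_neg, Real.exp_log (div_pos ha hb), inv_div, mul_div_cancel₀ _ ha.ne']
  -- a bump `ψ` supported in `[−ε/2, ε/2]`, viewed as a complex weight `w`
  let ψ : ContDiffBump (0 : ℝ) := ⟨ε / 4, ε / 2, by positivity, by linarith⟩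
  set w : ℝ → ℂ := fun τ ↦ ((ψ τ : ℝ) : ℂ) with hw
  have hwc : ContDiff ℝ (⊤ : ℕ∞) w := ofRealCLM.contDiff.comp ψ.contDiff
  have hws : HasCompactSupport w :=
    ψ.hasCompactSupport.comp_left (g := fun x : ℝ ↦ (x : ℂ)) Complex.ofReal_zero
  have hwε : ∀ τ, ε < |τ| → w τ = 0 := by
    intro τ hτ
    have : ψ τ = 0 := ψ.zero_of_le_dist (by
      show ε / 2 ≤ dist τ 0
      rw [Real.dist_eq, sub_zero]; linarith)
    simp [hw, this]
  -- the polynomial factor: exponents `e`, roots `S`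
  let e : ℂ → ℕ := fun w₀ ↦ F w₀ + if w₀ = ρ then 1 else 0
  let S : Finset ℂ := insert ρ hF.toFinset
  obtain ⟨φ, hφ, hφs, hφε, hφm⟩ := exists_weight_mul_prod hwc hws hwε S e
  have hφi : Integrable φ := hφ.continuous.integrable_of_hasCompactSupport hφs
  -- the mollified vector `h = ϑ(φ)G₀ ∈ K_b` and its completed transform
  have hhK : scalingOp φ G₀ ∈ sonineK b := scalingOp_mem_sonineK hφi hφε hb hba' hG₀K
  set Θψ : ℂ → ℂ := fun s ↦ ∫ τ : ℝ, w τ * cexp ((τ : ℂ) * (1 / 2 - s)) with hΘψ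
  set Θφ : ℂ → ℂ := fun s ↦ ∫ τ : ℝ, φ τ * cexp ((τ : ℂ) * (1 / 2 - s)) with hΘφ
  set Q : ℂ → ℂ := fun s ↦ ∏ w₀ ∈ S, (s - w₀) ^ e w₀ with hQ
  have hH : completedMellinEntire (scalingOp φ G₀ : ℝ → ℂ) = Θφ * G := by
    rw [completedMellinEntire_scalingOp hφ.continuous hφs ha hb hG₀K hhK]
    rfl
  have hΘφ_eq : Θφ = Q * Θψ := funext fun s ↦ hφm s
  have hΘψ_ent : Differentiable ℂ Θψ := differentiable_mollMultiplier hwc.continuous hws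
  have hΘψan : ∀ s, AnalyticAt ℂ Θψ s := fun s ↦ hΘψ_ent.analyticAt s
  have hQan : ∀ s, AnalyticAt ℂ Q s := fun s ↦
    Finset.analyticAt_fun_prod S fun x _ ↦ (analyticAt_id.sub analyticAt_const).pow _
  have hΘφan : ∀ s, AnalyticAt ℂ Θφ s := fun s ↦ by rw [hΘφ_eq]; exact (hQan s).mul (hΘψan s)
  -- `Θψ(1/2) = ∫ψ ≠ 0`, so `Θψ` has finite order everywhere
  have hΘψ_half : Θψ (1 / 2) ≠ 0 := by
    have : Θψ (1 / 2) = ((∫ τ : ℝ, ψ τ : ℝ) : ℂ) := by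
      simp only [hΘψ, hw, sub_self, mul_zero, Complex.exp_zero, mul_one]
      exact integral_ofReal
    rw [this, Complex.ofReal_ne_zero]
    exact (ψ.integral_pos (μ := volume)).ne'
  have hΘψ_ord : ∀ s, analyticOrderAt Θψ s ≠ ⊤ := by
    intro s htop
    rw [analyticOrderAt_eq_top] at htop
    have hzero : Θψ = fun _ ↦ 0 :=
      AnalyticOnNhd.eq_of_eventuallyEq (fun z _ ↦ hΘψan z) analyticOnNhd_const htop
    exact hΘψ_half (by rw [hzero])
  -- orders of `Θφ`
  have hordΘ : ∀ s, ((if s ∈ S then e s else 0 : ℕ) : ℕ∞) ≤ analyticOrderAt Θφ s := by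
    intro s
    rw [hΘφ_eq, analyticOrderAt_mul (hQan s) (hΘψan s), analyticOrderAt_prod_pow]
    exact le_self_add
  have hordΘ' : ∀ s, analyticOrderAt Θφ s ≠ ⊤ := by
    intro s
    rw [hΘφ_eq, analyticOrderAt_mul (hQan s) (hΘψan s), analyticOrderAt_prod_pow]
    exact WithTop.add_ne_top.2 ⟨WithTop.coe_ne_top, hΘψ_ord s⟩
  -- orders of `𝒢_h = Θφ·G`: at least `𝒵(w) + F(w)` everywhere, finite at `ρ`
  have hHan : ∀ s, AnalyticAt ℂ (Θφ * G) s := fun s ↦ (hΘφan s).mul (hGan s)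
  have hordH : ∀ s, ((Z s + F s : ℕ) : ℕ∞) ≤ analyticOrderAt (Θφ * G) s := by
    intro s
    rw [analyticOrderAt_mul (hΘφan s) (hGan s)]
    by_cases hsρ : s = ρ
    · subst hsρ
      have hmem : s ∈ S := Finset.mem_insert_self _ _
      have h1 : ((F s + 1 : ℕ) : ℕ∞) ≤ analyticOrderAt Θφ s := by
        have := hordΘ s
        simpa [hmem, e] using this
      rw [hordGρ]
      calc ((Z s + F s : ℕ) : ℕ∞) = ((F s + 1 : ℕ) : ℕ∞) + ((Z s - 1 : ℕ) : ℕ∞) := by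
            rw [← Nat.cast_add]; congr 1; omega
        _ ≤ analyticOrderAt Θφ s + ((Z s - 1 : ℕ) : ℕ∞) := add_le_add h1 le_rfl
    · have h2 := hordG s hsρ
      by_cases hsF : F s = 0
      · rw [hsF, add_zero]
        exact le_add_left h2
      · have hmem : s ∈ S := Finset.mem_insert_of_mem (hF.mem_toFinset.2 hsF)
        have h1 := hordΘ s
        simp only [hmem, if_true, e, hsρ, if_false, add_zero] at h1
        calc ((Z s + F s : ℕ) : ℕ∞) = ((F s : ℕ) : ℕ∞) + ((Z s : ℕ) : ℕ∞) := by
              rw [← Nat.cast_add, add_comm]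
          _ ≤ analyticOrderAt Θφ s + analyticOrderAt G s := add_le_add h1 h2
  have hordHρ : analyticOrderAt (Θφ * G) ρ ≠ ⊤ := by
    rw [analyticOrderAt_mul (hΘφan ρ) (hGan ρ), hordGρ]
    exact WithTop.add_ne_top.2 ⟨hordΘ' ρ, WithTop.coe_ne_top⟩
  -- vanishing of `𝒢_h^{(k)}(w)` for `k < 𝒵(w) + F(w)`
  have hvan : ∀ (s : ℂ) (k : ℕ), k < Z s + F s →
      iteratedDeriv k (completedMellinEntire (scalingOp φ G₀ : ℝ → ℂ)) s = 0 := by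
    intro s k hk
    rw [hH]
    exact (natCast_le_analyticOrderAt_iff_iteratedDeriv_eq_zero (hHan s)).1 (hordH s) k hk
  -- `h ≠ 0`
  have hh0 : scalingOp φ G₀ ≠ 0 := by
    intro h0
    have hstrip : ∀ s : ℂ, 1 / 2 < s.re → s.re < 1 → (Θφ * G) s = 0 := by
      intro s hs1 hs2
      rw [← hH, (hasCompletedMellinEntire_of_mem_sonineK hb hhK).2 s hs1 hs2,
        rightMellin_eq_zero_of_ae_zero _ s, mul_zero]
      rw [h0]
      exact Lp.coeFn_zero ℂ 2 (volume : Measure ℝ)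
    have hopen : IsOpen {s : ℂ | 1 / 2 < s.re ∧ s.re < 1} :=
      (isOpen_lt continuous_const Complex.continuous_re).inter
        (isOpen_lt Complex.continuous_re continuous_const)
    have hmem : (3 / 4 : ℂ) ∈ {s : ℂ | 1 / 2 < s.re ∧ s.re < 1} := by
      simp only [Set.mem_setOf_eq]; norm_num
    have hev : (Θφ * G) =ᶠ[𝓝 (3 / 4 : ℂ)] fun _ ↦ (0 : ℂ) := by
      filter_upwards [hopen.mem_nhds hmem] with s hs using hstrip s hs.1 hs.2
    have hzero : Θφ * G = fun _ ↦ 0 :=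
      AnalyticOnNhd.eq_of_eventuallyEq (fun s _ ↦ hHan s) analyticOnNhd_const hev
    apply hordHρ
    rw [analyticOrderAt_eq_top, hzero]
    exact Eventually.of_forall fun _ ↦ rfl
  -- the conjugate `f = h̄ ∈ K_b`
  obtain ⟨f, hf⟩ := exists_conj (scalingOp φ G₀)
  have hfK : f ∈ sonineK b := mem_sonineK_of_conj hhK hf
  have hconj : ((scalingOp φ G₀ : Lp ℂ 2 (volume : Measure ℝ)) : ℝ → ℂ) =ᵐ[volume]
      fun x ↦ conj ((f : ℝ → ℂ) x) := by
    filter_upwards [hf] with x hx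
    rw [hx, Complex.conj_conj]
  refine ⟨f, hfK, ?_, fun s k hk ↦ ?_⟩
  · intro hf0
    apply hh0
    apply Lp.ext
    filter_upwards [hconj, Lp.coeFn_zero ℂ 2 (volume : Measure ℝ),
      (show (f : ℝ → ℂ) =ᵐ[volume] 0 by rw [hf0]; exact Lp.coeFn_zero ℂ 2 (volume : Measure ℝ))]
      with x h1 h2 h3
    rw [h1, h3, h2]
    simp
  · have hZv := hZ b hb s k
    rw [inner_eq_zero_symm, inner_eq_setIntegral_Ioi hfK.1 hZv.1.1 hconj]
    calc ∫ t in Ioi (0 : ℝ), (sonineZ b s k : ℝ → ℂ) t * (((2 : ℂ) • scalingOp φ G₀ :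
          Lp ℂ 2 (volume : Measure ℝ)) : ℝ → ℂ) t
        = ∫ t in Ioi (0 : ℝ), 2 * ((scalingOp φ G₀ : ℝ → ℂ) t * (sonineZ b s k : ℝ → ℂ) t) := by
          refine integral_congr_ae ((ae_restrict_of_ae (Lp.coeFn_smul (2 : ℂ)
            (scalingOp φ G₀))).mono fun t ht ↦ ?_)
          beta_reduce
          rw [ht, Pi.smul_apply, smul_eq_mul]
          ring
      _ = 2 * iteratedDeriv k (completedMellinEntire (scalingOp φ G₀ : ℝ → ℂ)) s := by
          rw [integral_const_mul, hZv.2 _ hhK]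
      _ = 0 := by rw [hvan s k hk, mul_zero]

/-! ## G. Lemmas 7.6 and 7.5 -/

/-- RH-FREE. **Burnol 2004b, Lemma 7.6, modulo the existence of the `§7` evaluators** (`hZ`: the
defining property of the `ε`-chosen `sonineZ c w k` for every `c > 0`, `w ∈ ℂ`, `k` — de Branges'
Thm. 2.1 + Riesz): "If the system of evaluators associated in a given `K_a` to a (non-empty) multiset
`𝒵` is minimal, then it is not complete in any `K_b` with `b < a`, even after adding to the system of
evaluators associated with `𝒵` arbitrarily finitely many other evaluators." Proof as printed
(TeX l.1472–1510): the non-zero `f ∈ K_b` of `exists_ne_zero_mem_sonineK_inner_sonineZ_eq_zero` is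
orthogonal to every vector of the system, which is therefore not complete
(`BurnolSonineIndex.eq_zero_of_isCompleteSystemIn`).
[cite: Burnol2004b, Lemma 7.6 (arXiv:math/0203120v7 p. 19, TeX l.1497–1510)] -/
theorem Burnol2004b_lemma7_6_of
    (hZ : ∀ c : ℝ, 0 < c → ∀ (w : ℂ) (k : ℕ), IsSonineZ c w k (sonineZ c w k)) :
    Burnol2004b_lemma7_6 := by
  intro Z hZ0 _ a ha hmin b hb hba F hF hc
  obtain ⟨f, hfK, hf0, hforth⟩ :=
    exists_ne_zero_mem_sonineK_inner_sonineZ_eq_zero hZ hZ0 ha hmin hb hba hF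
  exact hf0 (BurnolSonineIndex.eq_zero_of_isCompleteSystemIn hc hfK fun p ↦ hforth p.1.1 p.1.2 p.2)

/-- RH-FREE. **Burnol 2004b, Lemma 7.5, modulo the existence of the `§7` evaluators**: "If the system
of evaluators associated in a given `K_a` to a (non-empty) multiset `𝒵` is minimal, then it is not
complete in any `K_b` with `b < a`." (The case `F = 0` of the argument for Lemma 7.6.)
[cite: Burnol2004b, Lemma 7.5 (arXiv:math/0203120v7 p. 18, TeX l.1466–1490)] -/
theorem Burnol2004b_lemma7_5_of
    (hZ : ∀ c : ℝ, 0 < c → ∀ (w : ℂ) (k : ℕ), IsSonineZ c w k (sonineZ c w k)) :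
    Burnol2004b_lemma7_5 := by
  intro Z hZ0 _ a ha hmin b hb hba hc
  obtain ⟨f, hfK, hf0, hforth⟩ := exists_ne_zero_mem_sonineK_inner_sonineZ_eq_zero hZ hZ0 ha hmin
    hb hba (F := 0) (by simp)
  exact hf0 (BurnolSonineIndex.eq_zero_of_isCompleteSystemIn hc hfK fun p ↦
    hforth p.1.1 p.1.2 (by simpa using p.2))

end BurnolNonComplete

/-- RH-FREE. **Burnol 2004b, Lemma 7.6** (discharge of the named fact `Burnol2004b_lemma7_6`): "If the
system of evaluators associated in a given `K_a` to a (non-empty) multiset `𝒵` is minimal, then it is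
not complete in any `K_b` with `b < a`, even after adding to the system of evaluators associated with
`𝒵` arbitrarily finitely many other evaluators." — `BurnolNonComplete.Burnol2004b_lemma7_6_of` fed
with the existence of the evaluators `SonineMultiset.isSonineZ_sonineZ`.
[cite: Burnol2004b, Lemma 7.6 (arXiv:math/0203120v7 p. 19, TeX l.1497–1510)] -/
theorem Burnol2004b_lemma7_6_holds : Burnol2004b_lemma7_6 :=
  BurnolNonComplete.Burnol2004b_lemma7_6_of fun _ hc w k ↦ SonineMultiset.isSonineZ_sonineZ hc w k

/-- RH-FREE. **Burnol 2004b, Lemma 7.5** (discharge of the named fact `Burnol2004b_lemma7_5`): "If the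
system of evaluators associated in a given `K_a` to a (non-empty) multiset `𝒵` is minimal, then it is
not complete in any `K_b` with `b < a`." [cite: Burnol2004b, Lemma 7.5 (arXiv:math/0203120v7 p. 18, TeX l.1466–1490)] -/
theorem Burnol2004b_lemma7_5_holds : Burnol2004b_lemma7_5 :=
  BurnolNonComplete.Burnol2004b_lemma7_5_of fun _ hc w k ↦ SonineMultiset.isSonineZ_sonineZ hc w k

end Literature.NumberTheory.LFunctions
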